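import Summits.BirchSwinnertonDyer.BirchSwinnertonDyer.Theorems.ResidualThetaTransportAtTwoThetaTransportResidualSchurMatrix
import Literature.NumberTheory.EllipticCurves.PointDivisibilityProofs
import Literature.NumberTheory.EllipticCurves.SelmerCorankProofs
import HarnessLib

/-!
# Integral Schur at `2` on the habitat: a decomposition-equivariant additive endomorphism of `W[2^∞]` is a `2`-adic scalar
# (crux (R≥)ᵖ `ResidualThetaCountLowerPureAtTwo`, line «bt26-lambda», toward the Θ-independence of stub S2's condition at `2`)

Route `ResidualThetaTransportAtTwo` (RTT), crux (R≥)ᵖ `ResidualThetaCountLowerPureAtTwo` (stmt-BirchSwinnertonDyer-26074),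
line «bt26-lambda»; seat `prover-bsd-rtt-w3` g0 (width helper, `--supports`, closes nothing). HONEST FRAMING: THEOREMS ONLY
(no definition, no named fact, no instance, no `sorry`); CONDITIONAL on the route's print binder
`SerreSupersingularDecompositionImageInput` (Serre 1972 Prop. 12, item stmt-BirchSwinnertonDyer-27793) =
`Literature.NumberTheory.EllipticCurves.serre1972_supersingular_decompositionSubgroup_image`, taken as the hypothesis `hSe`
exactly like `…ResidualSchurAtTwo` / `…ResidualSchurMatrix`; BSD is not proved by any of this.

WHY. Stub S2 (`stub_cmLambdaLower`) and `stub_transport` quantify over EVERY local transport datum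
`Θ_v : A_g ≃+ (W[2^∞])ⁿ` equivariant for the decomposition group at `v ∣ 2`; the skeleton asserts (as READING) that the
transported plus-Kummer condition at `2` does not depend on `Θ` because `End_{D₂}(T₂W) = ℤ₂`. This file makes the
integral Schur statement KERNEL: two data differ by a `D₂`-equivariant additive automorphism of `(W[2^∞])ⁿ`, and such a
map is, on every finite layer `W[2^m]ⁿ`, an INTEGER MATRIX.

WHAT.
* `exists_two_nsmul_eq_primary` — `W[2^∞]` is `2`-divisible (from the tree's `zsmul_geomPoints_surjective_holds`).
* `exists_nsmul_eq_of_forall_two_nsmul` — residual step: a `D_v`-equivariant additive `u : W[2^∞] → W[2^∞]` is `0` or `id` on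
  `W[2]` (the tree's `schur_torsionBy`, granted Serre), i.e. `u P = ε • P` for `2P = 0`, `ε ∈ {0,1}`.
* **`decomp_equivariant_addMonoidHom_primary_eq_nsmul`** — INTEGRAL SCHUR: for every `m` there is `c : ℕ` with `u P = c • P`
  whenever `2^m P = 0` (dévissage: `u − ε` kills `W[2]`, so `u − ε = u₁ ∘ [2]` with `u₁` again equivariant; induct).
* **`decomp_equivariant_addMonoidHom_pi_primary_eq_sum_nsmul`** — matrix form: a `D_v`-equivariant additive
  `Φ : (W[2^∞])ⁿ → (W[2^∞])ⁿ'` is, on `2^m`-torsion vectors, `(Φ x)_i = ∑_l C i l • x_l` with `C ∈ ℕ^{n'×n}`.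

References: [SerreInventiones1972] §1.11 Prop. 12, §2.2; [SilvermanAEC2009] III.§7, VIII.§2.
-/

set_option autoImplicit false
-- the Theorems namespace of this sub repeats the summit name by design (D-0017 nested layout)
set_option linter.dupNamespace false

noncomputable section

open scoped AddSubgroup
open WeierstrassCurve NumberField Field IsDedekindDomain Literature Literature.NumberTheory.EllipticCurves
  Literature.NumberTheory.GaloisRepresentations Literature.NumberTheory.EllipticCurves.Rank1Residual

namespace Summit.BirchSwinnertonDyer.BirchSwinnertonDyer.Theorems.ThetaTransport

variable (W : WeierstrassCurve ℚ) [W.IsElliptic] [W.IsGloballyMinimal]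

omit [W.IsGloballyMinimal] in
/-- `W[2^∞] = E(ℚ̄)[2^∞]` is `2`-divisible: every point is twice a point of `W[2^∞]` (multiplication by `2` is onto on
`E(ℚ̄)`, and a half of a `2`-power torsion point is `2`-power torsion). [cite: SilvermanAEC2009, §VIII.2, Prop. III.4.2(a)] -/
theorem exists_two_nsmul_eq_primary (P : ↥(W.geomPrimaryTorsion 2)) :
    ∃ Q : ↥(W.geomPrimaryTorsion 2), 2 • Q = P := by
  obtain ⟨k, hk⟩ := (AddCommGroup.mem_primaryComponent).1 P.2
  obtain ⟨B, hB⟩ := exists_nsmul_eq_geomPoints W W.zsmul_geomPoints_surjective_holds two_ne_zero (P : geomPoints W)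
  refine ⟨⟨B, (AddCommGroup.mem_primaryComponent).2 ⟨k + 1, ?_⟩⟩, Subtype.ext (by rw [AddSubmonoidClass.coe_nsmul]; exact hB)⟩
  rw [pow_succ, mul_smul, hB]
  exact hk

/-- Residual step (granted Serre 1972 Prop. 12): for `W` on the habitat (`GoodSS W 2`, `a₂ = 0`), `v ∣ 2`, and an additive
`u : W[2^∞] → W[2^∞]` commuting with `resGalOfEmb (closureEmb ℚ_v) δ` for all `δ ∈ Γ_{ℚ_v}`, there is `ε ∈ {0, 1}` with
`u P = ε • P` for every `P` with `2 • P = 0` (restrict `u` to `V₂ = (W[2^∞])[2]` and apply `schur_torsionBy`).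
[cite: SerreInventiones1972, §1.11 Prop. 12 (c),(d); §2.2] -/
theorem exists_nsmul_eq_of_forall_two_nsmul (hSe : serre1972_supersingular_decompositionSubgroup_image) (hss : GoodSS W 2)
    (ha2 : W.frobeniusTrace 2 = 0) (v : HeightOneSpectrum (𝓞 ℚ)) (hv : ((2 : ℕ) : 𝓞 ℚ) ∈ v.asIdeal)
    (u : ↥(W.geomPrimaryTorsion 2) →+ ↥(W.geomPrimaryTorsion 2))
    (hu : ∀ (δ : absoluteGaloisGroup (v.adicCompletion ℚ)) (P : ↥(W.geomPrimaryTorsion 2)),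
      u (resGalOfEmb (closureEmb (K := ℚ) (v.adicCompletion ℚ)) δ • P) =
        resGalOfEmb (closureEmb (K := ℚ) (v.adicCompletion ℚ)) δ • u P) :
    ∃ ε : ℕ, ε ≤ 1 ∧ ∀ P : ↥(W.geomPrimaryTorsion 2), 2 • P = 0 → u P = ε • P := by
  -- `u` preserves `V₂`
  have hmem : ∀ P : ↥(AddSubgroup.torsionBy ↥(W.geomPrimaryTorsion 2) (2 : ℤ)),
      u (P : ↥(W.geomPrimaryTorsion 2)) ∈ AddSubgroup.torsionBy ↥(W.geomPrimaryTorsion 2) (2 : ℤ) := fun P ↦ by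
    have hP : (2 : ℤ) • (P : ↥(W.geomPrimaryTorsion 2)) = 0 := (Submodule.mem_torsionBy_iff (2 : ℤ) _).1 P.2
    refine (Submodule.mem_torsionBy_iff (2 : ℤ) _).2 ?_
    change (2 : ℤ) • u (P : ↥(W.geomPrimaryTorsion 2)) = 0
    rw [← map_zsmul, hP, map_zero]
  -- the restriction `w : V₂ →+ V₂`
  obtain ⟨w, hw⟩ : ∃ w : ↥(AddSubgroup.torsionBy ↥(W.geomPrimaryTorsion 2) (2 : ℤ)) →+
      ↥(AddSubgroup.torsionBy ↥(W.geomPrimaryTorsion 2) (2 : ℤ)),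
      ∀ P, ((w P : ↥(AddSubgroup.torsionBy ↥(W.geomPrimaryTorsion 2) (2 : ℤ))) : ↥(W.geomPrimaryTorsion 2)) =
        u (P : ↥(W.geomPrimaryTorsion 2)) :=
    ⟨(u.comp (AddSubgroup.torsionBy ↥(W.geomPrimaryTorsion 2) (2 : ℤ)).subtype).codRestrict _ fun P ↦ hmem P,
      fun _ ↦ rfl⟩
  have hwsmul : ∀ (δ : absoluteGaloisGroup (v.adicCompletion ℚ)) (P : ↥(AddSubgroup.torsionBy ↥(W.geomPrimaryTorsion 2) (2 : ℤ))),
      w (resGalOfEmb (closureEmb (K := ℚ) (v.adicCompletion ℚ)) δ • P) =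
        resGalOfEmb (closureEmb (K := ℚ) (v.adicCompletion ℚ)) δ • w P := fun δ P ↦ by
    apply Subtype.ext
    rw [hw, Literature.NumberTheory.EllipticCurves.AddSubgroup.torsionBy.coe_smul,
      Literature.NumberTheory.EllipticCurves.AddSubgroup.torsionBy.coe_smul, hu, hw]
  have h2 : ∀ P : ↥(W.geomPrimaryTorsion 2), 2 • P = 0 → P ∈ AddSubgroup.torsionBy ↥(W.geomPrimaryTorsion 2) (2 : ℤ) :=
    fun P hP ↦ (Submodule.mem_torsionBy_iff (2 : ℤ) _).2 (by rw [ofNat_zsmul]; exact hP)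
  rcases schur_torsionBy W hSe hss ha2 v hv w hwsmul with h0 | h1
  · refine ⟨0, zero_le_one, fun P hP ↦ ?_⟩
    have := congrArg (fun Q : ↥(AddSubgroup.torsionBy ↥(W.geomPrimaryTorsion 2) (2 : ℤ)) ↦ (Q : ↥(W.geomPrimaryTorsion 2)))
      (h0 ⟨P, h2 P hP⟩)
    simp only [hw, ZeroMemClass.coe_zero] at this
    rw [this, zero_smul]
  · refine ⟨1, le_rfl, fun P hP ↦ ?_⟩
    have := congrArg (fun Q : ↥(AddSubgroup.torsionBy ↥(W.geomPrimaryTorsion 2) (2 : ℤ)) ↦ (Q : ↥(W.geomPrimaryTorsion 2)))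
      (h1 ⟨P, h2 P hP⟩)
    simp only [hw] at this
    rw [this, one_smul]

/-- **Integral Schur at `2` on the habitat** (granted Serre 1972 Prop. 12). For `W/ℚ` globally minimal with good supersingular
reduction at `2` and `a₂(W) = 0`, a place `v ∣ 2`, and an additive endomorphism `u` of `W[2^∞] = E(ℚ̄)[2^∞]` commuting with the
action of every `resGalOfEmb (closureEmb ℚ_v) δ`, `δ ∈ Γ_{ℚ_v}`: for every `m` there is an integer `c` with `u P = c • P` for all
`P ∈ W[2^m]`, i.e. `u` is multiplication by a `2`-adic integer (`End_{D_v}(W[2^∞]) = ℤ₂`). Proof by dévissage on `m`: by the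
residual step `u − ε` (`ε ∈ {0,1}`) kills `W[2]`, hence factors as `u₁ ∘ [2]` through the `2`-divisible group `W[2^∞]`
(`AddMonoidHom.liftOfSurjective`), `u₁` is again equivariant, and `u = ε + 2c₁` on `W[2^{m+1}]` if `u₁ = c₁` on `W[2^m]`.
[cite: SerreInventiones1972, §1.11 Prop. 12 (c),(d); §2.2] [cite: SilvermanAEC2009, III.§7] -/
theorem decomp_equivariant_addMonoidHom_primary_eq_nsmul (hSe : serre1972_supersingular_decompositionSubgroup_image)
    (hss : GoodSS W 2) (ha2 : W.frobeniusTrace 2 = 0) (v : HeightOneSpectrum (𝓞 ℚ)) (hv : ((2 : ℕ) : 𝓞 ℚ) ∈ v.asIdeal)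
    (m : ℕ) (u : ↥(W.geomPrimaryTorsion 2) →+ ↥(W.geomPrimaryTorsion 2))
    (hu : ∀ (δ : absoluteGaloisGroup (v.adicCompletion ℚ)) (P : ↥(W.geomPrimaryTorsion 2)),
      u (resGalOfEmb (closureEmb (K := ℚ) (v.adicCompletion ℚ)) δ • P) =
        resGalOfEmb (closureEmb (K := ℚ) (v.adicCompletion ℚ)) δ • u P) :
    ∃ c : ℕ, ∀ P : ↥(W.geomPrimaryTorsion 2), 2 ^ m • P = 0 → u P = c • P := by
  induction m generalizing u with
  | zero =>
    refine ⟨0, fun P hP ↦ ?_⟩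
    rw [pow_zero, one_smul] at hP
    rw [hP, map_zero, zero_smul]
  | succ m ih =>
    -- residual step
    obtain ⟨ε, -, hε⟩ := exists_nsmul_eq_of_forall_two_nsmul W hSe hss ha2 v hv u hu
    -- `u' = u − ε` kills `W[2]` and is equivariant
    obtain ⟨u', hu'⟩ : ∃ u' : ↥(W.geomPrimaryTorsion 2) →+ ↥(W.geomPrimaryTorsion 2), ∀ P, u' P = u P - ε • P :=
      ⟨AddMonoidHom.mk' (fun P ↦ u P - ε • P) fun P Q ↦ by rw [map_add, smul_add]; abel, fun _ ↦ rfl⟩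
    have hu'2 : ∀ P : ↥(W.geomPrimaryTorsion 2), 2 • P = 0 → u' P = 0 := fun P hP ↦ by
      rw [hu', hε P hP, sub_self]
    have hu'smul : ∀ (δ : absoluteGaloisGroup (v.adicCompletion ℚ)) (P : ↥(W.geomPrimaryTorsion 2)),
        u' (resGalOfEmb (closureEmb (K := ℚ) (v.adicCompletion ℚ)) δ • P) =
          resGalOfEmb (closureEmb (K := ℚ) (v.adicCompletion ℚ)) δ • u' P := fun δ P ↦ by
      rw [hu', hu', hu, smul_sub, smul_comm ε]
    -- multiplication by `2` on `W[2^∞]`, onto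
    obtain ⟨two, htwo⟩ : ∃ two : ↥(W.geomPrimaryTorsion 2) →+ ↥(W.geomPrimaryTorsion 2), ∀ P, two P = 2 • P :=
      ⟨AddMonoidHom.mk' (fun P ↦ 2 • P) fun P Q ↦ smul_add 2 P Q, fun _ ↦ rfl⟩
    have htwosurj : Function.Surjective two := fun P ↦ by
      obtain ⟨Q, hQ⟩ := exists_two_nsmul_eq_primary W P
      exact ⟨Q, by rw [htwo, hQ]⟩
    have hker : two.ker ≤ u'.ker := fun P hP ↦ by
      rw [AddMonoidHom.mem_ker] at hP ⊢
      rw [htwo] at hP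
      exact hu'2 P hP
    -- `u' = u₁ ∘ [2]`
    obtain ⟨u₁, hu₁⟩ : ∃ u₁ : ↥(W.geomPrimaryTorsion 2) →+ ↥(W.geomPrimaryTorsion 2), ∀ P, u₁ (2 • P) = u' P :=
      ⟨two.liftOfSurjective htwosurj ⟨u', hker⟩, fun P ↦ by
        rw [← htwo]; exact two.liftOfRightInverse_comp_apply _ _ ⟨u', hker⟩ P⟩
    have hu₁smul : ∀ (δ : absoluteGaloisGroup (v.adicCompletion ℚ)) (P : ↥(W.geomPrimaryTorsion 2)),
        u₁ (resGalOfEmb (closureEmb (K := ℚ) (v.adicCompletion ℚ)) δ • P) =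
          resGalOfEmb (closureEmb (K := ℚ) (v.adicCompletion ℚ)) δ • u₁ P := fun δ P ↦ by
      obtain ⟨Q, rfl⟩ := exists_two_nsmul_eq_primary W P
      rw [hu₁, ← hu'smul, ← hu₁, smul_comm]
    obtain ⟨c₁, hc₁⟩ := ih u₁ hu₁smul
    refine ⟨ε + c₁ * 2, fun P hP ↦ ?_⟩
    have h2P : 2 ^ m • (2 • P) = 0 := by rw [← mul_smul, ← pow_succ, hP]
    have key : u P = ε • P + u' P := by rw [hu', add_sub_cancel]
    rw [key, ← hu₁, hc₁ _ h2P, add_smul, mul_smul]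

/-- **Integral Schur, matrix form** (granted Serre 1972 Prop. 12). On the habitat, `v ∣ 2`: an additive map
`Φ : (W[2^∞])ⁿ → (W[2^∞])ⁿ'` commuting coordinatewise with the action of `resGalOfEmb (closureEmb ℚ_v) δ`, `δ ∈ Γ_{ℚ_v}`, is an
integer matrix on every finite layer: for every `m` there is `C ∈ ℕ^{n'×n}` with `(Φ x)_i = ∑_l C i l • x_l` whenever
`2^m x = 0`. (Entry maps `P ↦ (Φ (δ_l P))_i` are equivariant endomorphisms of `W[2^∞]`; apply the scalar form.)
[cite: SerreInventiones1972, §1.11 Prop. 12; §2.2] -/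
theorem decomp_equivariant_addMonoidHom_pi_primary_eq_sum_nsmul (hSe : serre1972_supersingular_decompositionSubgroup_image)
    (hss : GoodSS W 2) (ha2 : W.frobeniusTrace 2 = 0) (v : HeightOneSpectrum (𝓞 ℚ)) (hv : ((2 : ℕ) : 𝓞 ℚ) ∈ v.asIdeal)
    {n n' : ℕ} (m : ℕ) (Φ : (Fin n → ↥(W.geomPrimaryTorsion 2)) →+ (Fin n' → ↥(W.geomPrimaryTorsion 2)))
    (hΦ : ∀ (δ : absoluteGaloisGroup (v.adicCompletion ℚ)) (x : Fin n → ↥(W.geomPrimaryTorsion 2)) (i : Fin n'),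
      Φ (resGalOfEmb (closureEmb (K := ℚ) (v.adicCompletion ℚ)) δ • x) i =
        resGalOfEmb (closureEmb (K := ℚ) (v.adicCompletion ℚ)) δ • Φ x i) :
    ∃ C : Fin n' → Fin n → ℕ, ∀ x : Fin n → ↥(W.geomPrimaryTorsion 2), 2 ^ m • x = 0 →
      ∀ i : Fin n', Φ x i = ∑ l, C i l • x l := by
  classical
  -- entry maps
  obtain ⟨w, hw⟩ : ∃ w : Fin n' → Fin n → (↥(W.geomPrimaryTorsion 2) →+ ↥(W.geomPrimaryTorsion 2)),
      ∀ i l P, w i l P = Φ (Pi.single l P) i :=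
    ⟨fun i l ↦ AddMonoidHom.mk' (fun P ↦ Φ (Pi.single l P) i) fun P Q ↦ by rw [Pi.single_add, map_add, Pi.add_apply],
      fun _ _ _ ↦ rfl⟩
  have hwsmul : ∀ i l (δ : absoluteGaloisGroup (v.adicCompletion ℚ)) (P : ↥(W.geomPrimaryTorsion 2)),
      w i l (resGalOfEmb (closureEmb (K := ℚ) (v.adicCompletion ℚ)) δ • P) =
        resGalOfEmb (closureEmb (K := ℚ) (v.adicCompletion ℚ)) δ • w i l P := fun i l δ P ↦ by
    rw [hw, hw, ← hΦ, Pi.single_smul]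
  have key : ∀ i l, ∃ c : ℕ, ∀ P : ↥(W.geomPrimaryTorsion 2), 2 ^ m • P = 0 → w i l P = c • P := fun i l ↦
    decomp_equivariant_addMonoidHom_primary_eq_nsmul W hSe hss ha2 v hv m (w i l) (hwsmul i l)
  choose C hC using key
  refine ⟨C, fun x hx i ↦ ?_⟩
  have hxl : ∀ l, 2 ^ m • x l = 0 := fun l ↦ by rw [← Pi.smul_apply, hx, Pi.zero_apply]
  conv_lhs => rw [← Finset.univ_sum_single x, map_sum, Finset.sum_apply]
  exact Finset.sum_congr rfl fun l _ ↦ by rw [← hw, hC i l (x l) (hxl l)]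

/-! ### Θ-independence of the transported Kummer condition at `v ∣ 2` -/

section ThetaIndependence

variable {A : Type} [AddCommGroup A] [DistribMulAction (absoluteGaloisGroup ℚ) A]

omit [W.IsElliptic] [W.IsGloballyMinimal] [DistribMulAction (absoluteGaloisGroup ℚ) A] in
/-- Finitely many values in `A` are carried by `Θ : A ≃+ (W[2^∞])ⁿ` into a single finite layer `W[2^m]ⁿ`. [folklore] -/
theorem exists_pow_nsmul_map_eq_zero_of_finite {n : ℕ} (Θ : A ≃+ (Fin n → ↥(W.geomPrimaryTorsion 2)))
    {T : Type} (a : T → A) (hfin : (Set.range a).Finite) :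
    ∃ m : ℕ, ∀ t, 2 ^ m • Θ (a t) = 0 := by
  obtain ⟨m, hm⟩ := exists_pow_nsmul_eq_zero W (ι := ↥hfin.toFinset × Fin n) fun p ↦ Θ p.1.1 p.2
  refine ⟨m, fun t ↦ funext fun i ↦ ?_⟩
  have ht : a t ∈ hfin.toFinset := hfin.mem_toFinset.2 ⟨t, rfl⟩
  have := hm (⟨a t, ht⟩, i)
  rw [Pi.smul_apply, Pi.zero_apply]
  exact this

/-- **Θ-independence of the transported Kummer condition at `v ∣ 2`, one direction** (granted Serre 1972 Prop. 12). On the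
habitat, let `Θ : A ≃+ (W[2^∞])ⁿ` and `Θ' : A ≃+ (W[2^∞])ⁿ'` both commute coordinatewise with the decomposition group at
`v ∣ 2`, let `a : T → A` take finitely many values and `g : T → Γ_{ℚ_v}`, and let `L ≤ E(ℚ_v^{alg})` be any subgroup of local
points. If there are local points `Q_i` with `2ᵏ Q_i ∈ L` and `Θ(a t)_i = g_t Q_i − Q_i` (read in `E` over the closure of `ℚ_v`),
then the same holds for `Θ'` — with `Q'_i = ∑_l C i l • Q_l`, `C` the integer matrix of `Θ' ∘ Θ⁻¹` on the finite layer carrying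
all `Θ(a t)` (`decomp_equivariant_addMonoidHom_pi_primary_eq_sum_nsmul`). [cite: SerreInventiones1972, §1.11 Prop. 12; §2.2]
[cite: Kobayashi2003, Def. 1.1] -/
theorem kummerClause_of_kummerClause (hSe : serre1972_supersingular_decompositionSubgroup_image)
    (hss : GoodSS W 2) (ha2 : W.frobeniusTrace 2 = 0) (v : HeightOneSpectrum (𝓞 ℚ)) (hv : ((2 : ℕ) : 𝓞 ℚ) ∈ v.asIdeal)
    {n n' : ℕ} (Θ : A ≃+ (Fin n → ↥(W.geomPrimaryTorsion 2))) (Θ' : A ≃+ (Fin n' → ↥(W.geomPrimaryTorsion 2)))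
    (hΘ : ∀ (δ : absoluteGaloisGroup (v.adicCompletion ℚ)) (m : A) (i : Fin n),
      Θ (resGalOfEmb (closureEmb (K := ℚ) (v.adicCompletion ℚ)) δ • m) i =
        resGalOfEmb (closureEmb (K := ℚ) (v.adicCompletion ℚ)) δ • Θ m i)
    (hΘ' : ∀ (δ : absoluteGaloisGroup (v.adicCompletion ℚ)) (m : A) (i : Fin n'),
      Θ' (resGalOfEmb (closureEmb (K := ℚ) (v.adicCompletion ℚ)) δ • m) i =
        resGalOfEmb (closureEmb (K := ℚ) (v.adicCompletion ℚ)) δ • Θ' m i)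
    {T : Type} (a : T → A) (hfin : (Set.range a).Finite) (g : T → absoluteGaloisGroup (v.adicCompletion ℚ))
    (L : AddSubgroup (localPoints W (v.adicCompletion ℚ)))
    (h : ∃ (Q : Fin n → localPoints W (v.adicCompletion ℚ)) (k : ℕ), (∀ i, (2 ^ k) • Q i ∈ L) ∧
      ∀ t i, pointsMapOfEmb W (closureEmb (K := ℚ) (v.adicCompletion ℚ)) ((Θ (a t) i : ↥(W.geomPrimaryTorsion 2)) : W.geomPoints) =
        g t • Q i - Q i) :
    ∃ (Q' : Fin n' → localPoints W (v.adicCompletion ℚ)) (k : ℕ), (∀ i, (2 ^ k) • Q' i ∈ L) ∧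
      ∀ t i, pointsMapOfEmb W (closureEmb (K := ℚ) (v.adicCompletion ℚ)) ((Θ' (a t) i : ↥(W.geomPrimaryTorsion 2)) : W.geomPoints) =
        g t • Q' i - Q' i := by
  obtain ⟨Q, k, hQ, hId⟩ := h
  -- `Φ = Θ' ∘ Θ⁻¹` is equivariant
  obtain ⟨Φ, hΦ⟩ : ∃ Φ : (Fin n → ↥(W.geomPrimaryTorsion 2)) →+ (Fin n' → ↥(W.geomPrimaryTorsion 2)),
      ∀ x, Φ x = Θ' (Θ.symm x) :=
    ⟨(Θ' : A →+ (Fin n' → ↥(W.geomPrimaryTorsion 2))).comp (Θ.symm : (Fin n → ↥(W.geomPrimaryTorsion 2)) →+ A), fun _ ↦ rfl⟩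
  have hsymm : ∀ (δ : absoluteGaloisGroup (v.adicCompletion ℚ)) (x : Fin n → ↥(W.geomPrimaryTorsion 2)),
      Θ.symm (resGalOfEmb (closureEmb (K := ℚ) (v.adicCompletion ℚ)) δ • x) =
        resGalOfEmb (closureEmb (K := ℚ) (v.adicCompletion ℚ)) δ • Θ.symm x := fun δ x ↦ by
    apply Θ.injective
    rw [Θ.apply_symm_apply]
    funext i
    rw [hΘ, Θ.apply_symm_apply, Pi.smul_apply]
  have hΦsmul : ∀ (δ : absoluteGaloisGroup (v.adicCompletion ℚ)) (x : Fin n → ↥(W.geomPrimaryTorsion 2)) (i : Fin n'),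
      Φ (resGalOfEmb (closureEmb (K := ℚ) (v.adicCompletion ℚ)) δ • x) i =
        resGalOfEmb (closureEmb (K := ℚ) (v.adicCompletion ℚ)) δ • Φ x i := fun δ x i ↦ by
    rw [hΦ, hΦ, hsymm, hΘ']
  -- one finite layer carries every `Θ (a t)`; there `Φ` is an integer matrix `C`
  obtain ⟨m, hm⟩ := exists_pow_nsmul_map_eq_zero_of_finite W Θ a hfin
  obtain ⟨C, hC⟩ := decomp_equivariant_addMonoidHom_pi_primary_eq_sum_nsmul W hSe hss ha2 v hv m Φ hΦsmul
  have hΘ'C : ∀ t i, Θ' (a t) i = ∑ l, C i l • Θ (a t) l := fun t i ↦ by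
    rw [← hC (Θ (a t)) (hm t) i, hΦ, Θ.symm_apply_apply]
  refine ⟨fun i ↦ ∑ l, C i l • Q l, k, fun i ↦ ?_, fun t i ↦ ?_⟩
  · rw [Finset.smul_sum]
    exact L.sum_mem fun l _ ↦ by rw [smul_comm]; exact L.nsmul_mem (hQ l) _
  · rw [hΘ'C, AddSubmonoidClass.coe_finsetSum, map_sum, smul_sum_nsmul_sub]
    refine Finset.sum_congr rfl fun l _ ↦ ?_
    rw [AddSubmonoidClass.coe_nsmul, map_nsmul, hId]

/-- **Θ-independence of the transported Kummer condition at `v ∣ 2`** (granted Serre 1972 Prop. 12): for two local transport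
data `Θ`, `Θ'` as above, finitely-valued `a : T → A`, `g : T → Γ_{ℚ_v}` and any subgroup `L` of local points, the Kummer clause
`∃ Q k, 2ᵏQ ∈ L ∧ ∀ t i, Θ(a t)_i = g_t Q_i − Q_i` holds for `Θ` iff it holds for `Θ'`. [cite: SerreInventiones1972, §1.11 Prop. 12; §2.2]
[cite: Kobayashi2003, Def. 1.1] -/
theorem kummerClause_iff_kummerClause (hSe : serre1972_supersingular_decompositionSubgroup_image)
    (hss : GoodSS W 2) (ha2 : W.frobeniusTrace 2 = 0) (v : HeightOneSpectrum (𝓞 ℚ)) (hv : ((2 : ℕ) : 𝓞 ℚ) ∈ v.asIdeal)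
    {n n' : ℕ} (Θ : A ≃+ (Fin n → ↥(W.geomPrimaryTorsion 2))) (Θ' : A ≃+ (Fin n' → ↥(W.geomPrimaryTorsion 2)))
    (hΘ : ∀ (δ : absoluteGaloisGroup (v.adicCompletion ℚ)) (m : A) (i : Fin n),
      Θ (resGalOfEmb (closureEmb (K := ℚ) (v.adicCompletion ℚ)) δ • m) i =
        resGalOfEmb (closureEmb (K := ℚ) (v.adicCompletion ℚ)) δ • Θ m i)
    (hΘ' : ∀ (δ : absoluteGaloisGroup (v.adicCompletion ℚ)) (m : A) (i : Fin n'),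
      Θ' (resGalOfEmb (closureEmb (K := ℚ) (v.adicCompletion ℚ)) δ • m) i =
        resGalOfEmb (closureEmb (K := ℚ) (v.adicCompletion ℚ)) δ • Θ' m i)
    {T : Type} (a : T → A) (hfin : (Set.range a).Finite) (g : T → absoluteGaloisGroup (v.adicCompletion ℚ))
    (L : AddSubgroup (localPoints W (v.adicCompletion ℚ))) :
    (∃ (Q : Fin n → localPoints W (v.adicCompletion ℚ)) (k : ℕ), (∀ i, (2 ^ k) • Q i ∈ L) ∧
      ∀ t i, pointsMapOfEmb W (closureEmb (K := ℚ) (v.adicCompletion ℚ)) ((Θ (a t) i : ↥(W.geomPrimaryTorsion 2)) : W.geomPoints) =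
        g t • Q i - Q i) ↔
    ∃ (Q' : Fin n' → localPoints W (v.adicCompletion ℚ)) (k : ℕ), (∀ i, (2 ^ k) • Q' i ∈ L) ∧
      ∀ t i, pointsMapOfEmb W (closureEmb (K := ℚ) (v.adicCompletion ℚ)) ((Θ' (a t) i : ↥(W.geomPrimaryTorsion 2)) : W.geomPoints) =
        g t • Q' i - Q' i :=
  ⟨kummerClause_of_kummerClause W hSe hss ha2 v hv Θ Θ' hΘ hΘ' a hfin g L,
    kummerClause_of_kummerClause W hSe hss ha2 v hv Θ' Θ hΘ' hΘ a hfin g L⟩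

variable [TopologicalSpace A] [DiscreteTopology A]

/-- **Θ-independence of the crux's local clause at `v ∣ 2`** (granted Serre 1972 Prop. 12), in the shape printed in stubs
`stub_transport` / S2 `stub_cmLambdaLower` of line «bt26-lambda»: for a closed subgroup `H ≤ Γ_ℚ` (e.g. `Γ_{ℚ_∞} = κ.kerSubgroup`),
a continuous cocycle `φ` of `H` with values in the discrete module `A`, a subgroup `L` of local points (e.g. `⨆ₘ E⁺(ℚ_{m,v})`), and
two local transport data `Θ`, `Θ'` equivariant for the decomposition group at `v`: the clause
`∃ Q k, (∀ i, 2ᵏ Q_i ∈ L) ∧ ∀ τ ∈ H_v, ∀ i, Θ(φ(τ))_i = τ Q_i − Q_i` holds for `Θ` iff it holds for `Θ'`. The cocycle takes finitely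
many values because `H` is compact and `A` discrete. [cite: SerreInventiones1972, §1.11 Prop. 12; §2.2] [cite: Kobayashi2003, Def. 1.1]
[cite: SerreGaloisCohomology1997, I §2.2] -/
theorem transportedKummer_iff_of_decomp_equivariant (hSe : serre1972_supersingular_decompositionSubgroup_image)
    (hss : GoodSS W 2) (ha2 : W.frobeniusTrace 2 = 0) (v : HeightOneSpectrum (𝓞 ℚ)) (hv : ((2 : ℕ) : 𝓞 ℚ) ∈ v.asIdeal)
    (H : Subgroup (absoluteGaloisGroup ℚ)) (hH : IsClosed (H : Set (absoluteGaloisGroup ℚ)))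
    {n n' : ℕ} (Θ : A ≃+ (Fin n → ↥(W.geomPrimaryTorsion 2))) (Θ' : A ≃+ (Fin n' → ↥(W.geomPrimaryTorsion 2)))
    (hΘ : ∀ (δ : absoluteGaloisGroup (v.adicCompletion ℚ)) (m : A) (i : Fin n),
      Θ (resGalOfEmb (closureEmb (K := ℚ) (v.adicCompletion ℚ)) δ • m) i =
        resGalOfEmb (closureEmb (K := ℚ) (v.adicCompletion ℚ)) δ • Θ m i)
    (hΘ' : ∀ (δ : absoluteGaloisGroup (v.adicCompletion ℚ)) (m : A) (i : Fin n'),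
      Θ' (resGalOfEmb (closureEmb (K := ℚ) (v.adicCompletion ℚ)) δ • m) i =
        resGalOfEmb (closureEmb (K := ℚ) (v.adicCompletion ℚ)) δ • Θ' m i)
    (L : AddSubgroup (localPoints W (v.adicCompletion ℚ))) (φ : contOneCocycles (discreteTopRep H A)) :
    (∃ (Q : Fin n → localPoints W (v.adicCompletion ℚ)) (k : ℕ), (∀ i, (2 ^ k) • Q i ∈ L) ∧
      ∀ (τ : localSubgroupOfEmb H (closureEmb (K := ℚ) (v.adicCompletion ℚ))) (i : Fin n),
        pointsMapOfEmb W (closureEmb (K := ℚ) (v.adicCompletion ℚ))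
          ((Θ (φ.1 (resGalSubgroupOfEmb H (closureEmb (K := ℚ) (v.adicCompletion ℚ)) τ)) i : ↥(W.geomPrimaryTorsion 2)) :
            W.geomPoints) = (τ : absoluteGaloisGroup (v.adicCompletion ℚ)) • Q i - Q i) ↔
    ∃ (Q' : Fin n' → localPoints W (v.adicCompletion ℚ)) (k : ℕ), (∀ i, (2 ^ k) • Q' i ∈ L) ∧
      ∀ (τ : localSubgroupOfEmb H (closureEmb (K := ℚ) (v.adicCompletion ℚ))) (i : Fin n'),
        pointsMapOfEmb W (closureEmb (K := ℚ) (v.adicCompletion ℚ))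
          ((Θ' (φ.1 (resGalSubgroupOfEmb H (closureEmb (K := ℚ) (v.adicCompletion ℚ)) τ)) i : ↥(W.geomPrimaryTorsion 2)) :
            W.geomPoints) = (τ : absoluteGaloisGroup (v.adicCompletion ℚ)) • Q' i - Q' i := by
  haveI : CompactSpace H := isCompact_iff_compactSpace.mp hH.isCompact
  have hfinφ : (Set.range fun h : H ↦ (φ.1 h : A)).Finite := (isCompact_range φ.1.continuous).finite_of_discrete
  have hfin : (Set.range fun τ : localSubgroupOfEmb H (closureEmb (K := ℚ) (v.adicCompletion ℚ)) ↦
      (φ.1 (resGalSubgroupOfEmb H (closureEmb (K := ℚ) (v.adicCompletion ℚ)) τ) : A)).Finite :=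
    hfinφ.subset (by rintro _ ⟨τ, rfl⟩; exact ⟨_, rfl⟩)
  exact kummerClause_iff_kummerClause W hSe hss ha2 v hv Θ Θ' hΘ hΘ'
    (fun τ ↦ φ.1 (resGalSubgroupOfEmb H (closureEmb (K := ℚ) (v.adicCompletion ℚ)) τ)) hfin
    (fun τ ↦ (τ : absoluteGaloisGroup (v.adicCompletion ℚ))) L

end ThetaIndependence

end Summit.BirchSwinnertonDyer.BirchSwinnertonDyer.Theorems.ThetaTransport

end
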